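import Summits.PneNP.PneNP.Theses.PhaseTwins
import Summits.PneNP.PneNP.Theorems.PhaseTwinsPolyDepthTwinsAboveDefs
import Summits.PneNP.PneNP.Theorems.PhaseTwinsPolyDepthTwinsAboveChargeVisible
import Summits.PneNP.PneNP.Theorems.PhaseTwinsPolyDepthTwinsAboveMaxDegree
import Summits.PneNP.PneNP.Theorems.PolyDepthTwinsAbove.Negative.LoadBearing
import Summits.PneNP.PneNP.Theorems.PolyDepthTwinsAbove.Negative.TseitinGapCoupling
import Literature.Computability.Complexity.HardcoreInapproximabilityProofs
import Literature.ModelTheory.FiniteModelTheory.CFIMatchingGraphs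
import Literature.ModelTheory.FiniteModelTheory.CkEquivHomCount
import Literature.ModelTheory.FiniteModelTheory.CkEquivTransfer
import Literature.ModelTheory.FiniteModelTheory.CountingWidthProofs

/-!
# Line `annealed-cover-twins` for crux `PhaseTwins.PolyDepthTwinsAbove` (stmt-PneNP-2719)

Skeleton (crux-plan, planner-cruxplan-stmt-PneNP-2719-annealed-cover-twins-0, 2026-08-16) of the crux idea
`annealed-cover-twins` (crux-ideate r1 k3; triage r1-2: pass, r1-3: pass), with the triage sharpenings built
in: (a) the variational input is stated WITH its equality case as a gap around the two product phase profiles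
(`stub_coverGap`; the pointwise form "Λ(ν) ≤ Φ₁(marginals of ν)" — numerically FALSE at the symmetric point far
above threshold, TRIAGE-r1-2 — is NOT used), and as a POWER-law gap (exponent `ℓ` free), mirroring the tree's
`slyPhi1_local_gap`/`slyPhi1_uniform_gap` for `Φ₁` itself; (b) the port law is a statement about the law of the
port pattern given NOTHING (all profiles summed), i.e. conditioned on no port count (`stub_annealedPortLaw`);
(c) the tilted factorisation `A₁/A₀ = (1-T)/(1+T)` is its own exact finite-algebra stub (`stub_tseitinSum`);
(d) `n' = 2M^k` with `k` as large as the port-law rate requires (no `N log³ N` race; the crux only asks `∃ θ > 0`).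

THE LINE. Fix `Δ ≥ 3`, `λ > λ_c(Δ)`, `d := Δ`, the critical densities `(p⁺,p⁻)` and the tree two-cycle
`(q⁺,q⁻) = (p⁺/(1-p⁻), p⁻/(1-p⁺))` (`exists_slyCriticalDensities`, PROVED). Base: the 3-regular `η₃`-edge-expander
`R = base3 (zigzagParams.R m₁)` on `M` vertices without half-edges (PROVED), charges `c : Fin M → ZMod 2`.
The graph `acGraph R P τ S c` on the vertex type `PWVert M n' κ` of the sibling line (gadget vertices `(δ, a, x)`,
ends `(w, i, a, j)`, inner `(w, S', j)`):
* ONE deck-symmetric COVER GADGET per canonical dart `δ` on `{δ} × ZMod 2 × Fin n'`: the bipartite double cover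
  `(δ,a,x) — (δ,a+1,y)` of the multigraph `M₁ ∪ … ∪ M_{d-1} ∪ τ` on `Fin n'`, where `Mᵢ = S δ i` are `d-1`
  fixed-point-free involutions (perfect matchings) — the RANDOMNESS, `S ∈ (GSample n' (d-1))^{Dart M 3}` — and
  `τ` is ONE FIXED perfect matching of the non-port indices (`IsPortMatching P τ`; a fixed `τ` gives the same
  annealed counts as a random one, by averaging over the permutations of `Fin n'` fixing the ports); bulk vertices
  have degree `d`, the `2·2κ` port vertices `(δ, a, P (s, j))` degree `d-1`;
* `κ` parallel ten-vertex CFI complexes per base vertex (the sibling line's `cxGraph`: inner `(w,S',j)` —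
  end `(w,i,bit (c w) S' i,j)`), the end `(w,i,a,j)` plugged into the port vertex `(δ, a, P (s,j))` of the gadget
  `(δ,s) = canonEnd R (w,i)` — layer `a` of the SAME gadget for both values of `a`: anti-alignment is automatic,
  there is no pair coupling and no aligned sector (so `Negative.tseitinGap_false_without_coupling` has no instance
  here: its phase vectors live on `Dart × ZMod 2`, ours on `Dart`).
SAMPLEWISE (for EVERY `S`): max degree `≤ d = Δ` (`maxDegree_acGraph`, PROVED here); the gauge shift `a ↦ a + g δ`,
`S' ↦ S' + g|_w` is an isomorphism `acGraph c ≅ acGraph (c + ∂g)` because the deck involution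
`(δ,a,x) ↦ (δ,a+1,x)` is an automorphism of every cover gadget, so Duplicator wins the bijective `K`-pebble game
between any two charge vectors for `6K < ηM` (`stub_duplicator`, the landed `ParityWiredPorts.stub_duplicator`
mutatis mutandis). ANNEALED (the lever): `exists_twin_of_sum_le` (PROVED) turns the single first-moment
inequality `2·Σ_S Z(acGraph S 1_{w₀}) ≤ Σ_S Z(acGraph S 0)` into ONE sample `S*` with the twin inequality; the
three other conjuncts hold for `S*` because they hold for every sample. The inequality: (i) `stub_annealedPortLaw`
— for ONE cover gadget the annealed law of the port pattern is the symmetric mixture of the two PRODUCT laws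
(layer `0` occupied w.p. `q⁺`, layer `1` w.p. `q⁻`, or swapped) up to relative error `n'^{-θ₀}`, uniformly over
patterns, for `2κ ≤ n'^{θ₀}` ports (counting fixed-point-free involutions by type and pair profile = the exponent
`coverLambda`, Laplace localisation by `stub_coverGap`, port tilt `∝ λ^{|s|/d} ν_s^{(d-1)/d}` = the product law with
Sly's `q±` by the critical equations; the cover analogue of the tree's PROVED `sly_lemma33`, with a rate);
(ii) `stub_annealedConnector` — fibre decomposition of `Σ_S Z` over the gadget configurations + multilinearity of
`cxWeight` in the vacancies of DISTINCT ports: `Σ_S Z(acGraph S c) = (1 ± ε)^{3M} · C₁ · A_c` with the explicit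
Tseitin-type sum `A_c = acA … c = Σ_{Y : Dart → Bool} Π_w cxW(c w; phases seen at w)^κ`; (iii) `stub_tseitinSum`
— by the leg-flip covariance of the complex and the Fourier expansion over `U ⊆ Fin M` on the CONNECTED base,
`A_{1_{w₀}} (S^M + D^M) = A_0 (S^M - D^M)`, `S = F₀^κ + F₁^κ`, `D = F₀^κ - F₁^κ`, `F_e = cxW e ref`; (iv) charge
visibility `F₁ < F₀` is the LANDED `cxWeight_zero_sub_one_ref` (`F₀ - F₁ = λ⁴(q⁺-q⁻)³`), so with
`κ = ⌈log(4M)/log(F₀/F₁)⌉` one gets `S^M ≤ 2 D^M`, i.e. `A₁ ≤ A₀/3`, and the error budget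
`2(1+ε)^{3M} ≤ 3(1-ε)^{3M}` (`ε = n'^{-θ₀}`, `n' = 2M^k`, `kθ₀ > 1`) closes `2·Σ Z₁ ≤ Σ Z₀` (`stub_parameters`).
Depth: `K = ⌊η₃ M/7⌋ ≥ N^{θ'}`, `N = 6Mn' + 10Mκ ≤ 22 M^{k+1}`, `θ' = 1/(2k+2)`; hom counts by the PROVED Dvořák
bridge. NO named fact is used (`slyGadgetReduction` — the trust base of the picked line — is gone).

Stubs (6): `stub_coverGap` (L, HARDEST: new real analysis on an explicit 5-variable functional; numerics:
card (N1)/(N2), TRIAGE-r1-2 84 cases, TRIAGE-r1-3 15 cases), `stub_annealedPortLaw` (L–XL, charted by the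
tree's `HardcoreInapproximabilityFirstMoment`), `stub_annealedConnector` (L), `stub_tseitinSum` (M),
`stub_duplicator` (M), `stub_parameters` (M). The samplewise degree bound `maxDegree_acGraph` (the would-be seventh
stub) is PROVED in this file, which also certifies the construction `acRel` vertex class by vertex class.

Disproof.lean (cdisprove gen 1–2) honoured: `Negative.polyDepthTwinsAbove_false_without_threshold` — the line
uses `λ > λ_c(Δ)` at `exists_slyCriticalDensities` (no two-cycle, no `q⁻ < q⁺`, no `F₁ < F₀`, `T = 0` below
`λ_c`: the mechanism switches off exactly at the threshold, consistent with support 2724);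
`Negative.polyDepthTwinsAbove_false_without_degreeLB` — `3 ≤ Δ` is used for `d = Δ ≥ 3` (critical densities)
and for the degree-3 complex vertices; §2 (bare CFI only log-deep) — amplification by `κ ~ log M` complexes per
vertex inside ONE connected expander base, growing gadgets `n' = 2M^k`; §3(ii) factor 2 ⇔ factor c — we prove
factor 3 before errors; `Negative.tseitinGap_false_without_coupling` — no instance (no pair coupling, one phase bit
per edge). Negatives index PneNP (0265, 0988, 10247, 2493, 2222): unrelated.
-/

noncomputable section

open scoped Classical BigOperators

namespace Summit.PneNP.PneNP.Cruxes.PolyDepthTwinsAbove.AnnealedCoverTwins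

open Finset
open Summit.PneNP.PneNP.Cruxes.PolyDepthTwinsAbove.ParityWiredPorts (PWVert canonEnd canonEnd_injective
  card_filter_bit_le occP CxVert cxGraph cxWeight cxW pwPsi stub_chargeVisible cxWeight_zero_sub_one_ref
  cxWeight_one_ref_pos)
open Summit.PneNP.PneNP.Theorems.PolyDepthTwinsAbove.Negative (cxW_pos)
open Literature.Computability.Complexity (hardcoreZOn slyPhi1 exists_slyCriticalDensities sum_hardcoreZOn_fiber
  hardcoreZOn_nonneg hardcoreZOn_le_independencePolynomial)
open Literature.Computability.Complexity.Expander (RotGraph)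
open Literature.ModelTheory.FiniteModelTheory (CkEquiv)
open Literature.ModelTheory.FiniteModelTheory.TseitinColouring (Dart EdgeExpansion zigzagParams)
open Literature.ModelTheory.FiniteModelTheory.CFIMatching (bit Canon NoFixed base3 η₃ edgeExpansion_base3
  noFixed_base3 η₃_pos zmod2_add_self)
open Literature.Probability.LatticeModels (independencePolynomial hardCoreThreshold hardCoreThreshold_pos
  independencePolynomial_pos)
open Literature.Combinatorics.SimpleGraph (treewidth)
open Summit.PneNP.PneNP.Theses.PhaseTwins (PolyDepthTwinsAbove)

set_option linter.unusedVariables false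
set_option linter.dupNamespace false

variable {M n' κ dm : ℕ}

/-! ## The construction -/

/-- Fixed-point-free involutions of a finite type (its perfect matchings, as permutations). -/
def fpfInv (α : Type*) [DecidableEq α] [Fintype α] : Finset (Equiv.Perm α) :=
  Finset.univ.filter fun σ => (∀ x, σ (σ x) = x) ∧ ∀ x, σ x ≠ x

/-- The randomness of ONE cover gadget: `dm = d - 1` independent uniform perfect matchings of `Fin n'`. -/
def GSample (n' dm : ℕ) : Finset (Fin dm → Equiv.Perm (Fin n')) :=
  Fintype.piFinset fun _ => fpfInv (Fin n')

/-- `τ` is a perfect matching of the NON-port indices: an involution of `Fin n'` whose fixed points are exactly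
the `2κ` port indices `P (s, j)` (so ports have gadget-degree `d - 1`, bulk vertices `d`). -/
structure IsPortMatching (P : Fin 2 × Fin κ ↪ Fin n') (τ : Equiv.Perm (Fin n')) : Prop where
  invol : ∀ x, τ (τ x) = x
  fixed_iff : ∀ x, τ x = x ↔ x ∈ Set.range P

/-- Generating adjacency of one cover gadget on `ZMod 2 × Fin n'` (layer, index): the bipartite double cover of
`M₁ ∪ … ∪ M_{dm} ∪ τ`. -/
def gadRel (τ : Equiv.Perm (Fin n')) (σ : Fin dm → Equiv.Perm (Fin n')) :
    ZMod 2 × Fin n' → ZMod 2 × Fin n' → Prop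
  | (a, x), (b, y) => b = a + 1 ∧ x ≠ y ∧ ((∃ i, σ i x = y) ∨ τ x = y)

/-- One cover gadget (the deck-symmetric core `R_σ × K₂` of the idea card, ports included). -/
def gadGraph (τ : Equiv.Perm (Fin n')) (σ : Fin dm → Equiv.Perm (Fin n')) : SimpleGraph (ZMod 2 × Fin n') :=
  SimpleGraph.fromRel (gadRel τ σ)

/-- Port patterns: occupancy of the port vertex (layer `a`, index `P (s, j)`), as a function of `((s, j), a)`. -/
abbrev PortPat (κ : ℕ) : Type := (Fin 2 × Fin κ) × ZMod 2 → Bool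

/-- The port pattern of a gadget configuration. -/
def gadPat (P : Fin 2 × Fin κ ↪ Fin n') (I : Finset (ZMod 2 × Fin n')) : PortPat κ :=
  fun q => decide ((q.2, P q.1) ∈ I)

/-- `G(k)`: the ANNEALED restricted partition function of one gadget — total `λ`-weight, summed over the gadget
randomness, of the independent sets with port pattern `k`. -/
def gadG (P : Fin 2 × Fin κ ↪ Fin n') (τ : Equiv.Perm (Fin n')) (dm : ℕ) (lam : ℝ) (k : PortPat κ) : ℝ :=
  ∑ σ ∈ GSample n' dm, hardcoreZOn (gadGraph τ σ) lam (fun I => gadPat P I = k)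

/-- `Σ_k G(k) = Σ_σ Z(gadget)`: the annealed partition function of one gadget. -/
def gadTot (τ : Equiv.Perm (Fin n')) (dm : ℕ) (lam : ℝ) : ℝ :=
  ∑ σ ∈ GSample n' dm, independencePolynomial (gadGraph τ σ) lam

/-- Occupation probability of layer `a` of a gadget in phase `s` (`true` = layer `0` dense): `q⁺` for
`(s, a) = (true, 0), (false, 1)`, `q⁻` otherwise (the sibling line's `occP`). -/
def layerOcc (qp qm : ℝ) (s : Bool) (a : ZMod 2) : ℝ := occP qp qm (if a = 0 then s else !s)

/-- The PRODUCT port law in phase `s`: port vertices independent, layer `a` occupied w.p. `layerOcc qp qm s a`. -/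
def prodLaw (qp qm : ℝ) (s : Bool) (k : PortPat κ) : ℝ :=
  ∏ q, (if k q then layerOcc qp qm s q.2 else 1 - layerOcc qp qm s q.2)

/-- The symmetric mixture of the two product port laws (deck symmetry: both phases have weight `1/2`). -/
def mixLaw (qp qm : ℝ) (k : PortPat κ) : ℝ := (prodLaw qp qm true k + prodLaw qp qm false k) / 2

/-- Generating adjacency of the cover-wired CFI graph `acGraph R P τ S c`: (gadget) for CANONICAL `δ` the cover
gadget of the sample `S δ` on `{δ} × ZMod 2 × Fin n'` (non-canonical darts carry isolated junk, identical for all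
charges); (end–gadget) the end `(w, i, a, j)` is adjacent to the port vertex `(δ, a, P (s, j))` of the gadget
`(δ, s) = canonEnd R (w, i)` — layer `a` of ONE gadget; (inner–end) `(w, S', j) — (w, i, bit (c w) S' i, j)`. -/
def acRel (R : RotGraph M 3) (P : Fin 2 × Fin κ ↪ Fin n') (τ : Equiv.Perm (Fin n'))
    (S : Dart M 3 → Fin dm → Equiv.Perm (Fin n')) (c : Fin M → ZMod 2) :
    PWVert M n' κ → PWVert M n' κ → Prop
  | .inl (δ, a, x), .inl (δ', b, y) =>
      Canon R δ ∧ δ' = δ ∧ b = a + 1 ∧ x ≠ y ∧ ((∃ i, S δ i x = y) ∨ τ x = y)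
  | .inr (.inl (w, i, a, j)), .inl (δ', a', y) =>
      a' = a ∧ δ' = (canonEnd R (w, i)).1 ∧ y = P ((canonEnd R (w, i)).2, j)
  | .inr (.inr (w, S', j)), .inr (.inl (w', i, a, j')) => w' = w ∧ j' = j ∧ bit (c w) S' i = a
  | _, _ => False

/-- **The cover-wired CFI graph** over the base `R`, ports `P`, port matching `τ`, gadget sample `S`, charges `c`. -/
def acGraph (R : RotGraph M 3) (P : Fin 2 × Fin κ ↪ Fin n') (τ : Equiv.Perm (Fin n'))
    (S : Dart M 3 → Fin dm → Equiv.Perm (Fin n')) (c : Fin M → ZMod 2) : SimpleGraph (PWVert M n' κ) :=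
  SimpleGraph.fromRel (acRel R P τ S c)

/-- **The annealed partition function** `Σ_S Z(acGraph R P τ S c, λ)` over all gadget samples. -/
def annZ (R : RotGraph M 3) (P : Fin 2 × Fin κ ↪ Fin n') (τ : Equiv.Perm (Fin n')) (dm : ℕ)
    (c : Fin M → ZMod 2) (lam : ℝ) : ℝ :=
  ∑ S ∈ Fintype.piFinset (fun _ : Dart M 3 => GSample n' dm), independencePolynomial (acGraph R P τ S c) lam

/-- The phases SEEN by the complex at `w` under the edge phases `Y` (read at canonical darts): the end `(i, 0)`
sees layer `0` of the gadget of edge `(w, i)` (phase `Y`), the end `(i, 1)` layer `1` (phase `¬Y`) — so that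
`occP qp qm (seen R Y w (i, a)) = layerOcc qp qm (Y δ) a`; all `Y = true` is the reference pattern of `pwPsi`. -/
def seen (R : RotGraph M 3) (Y : Dart M 3 → Bool) (w : Fin M) : Fin 3 × ZMod 2 → Bool :=
  fun p => if p.2 = 0 then Y (canonEnd R (w, p.1)).1 else !Y (canonEnd R (w, p.1)).1

/-- **The Tseitin-type sum** `A_c = Σ_{Y : Dart → Bool} Π_w cxW(c w; seen Y w)^κ`: the main term of the annealed
partition function once the port law is the mixture of product laws (one phase bit per edge; `Y` is read only at
canonical darts, the other coordinates contribute a charge-independent power of `2`). -/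
def acA (R : RotGraph M 3) (lam qp qm : ℝ) (κ : ℕ) (c : Fin M → ZMod 2) : ℝ :=
  ∑ Y : Dart M 3 → Bool, ∏ w : Fin M, cxW lam qp qm (c w) (seen R Y w) ^ κ

/-- `F_e^κ`: the `κ`-th power of the complex factor with local charge `e` in the reference pattern of `pwPsi`. -/
def cxF (lam qp qm : ℝ) (κ : ℕ) (e : ZMod 2) : ℝ := cxW lam qp qm e (fun p => decide (p.2 = 0)) ^ κ

/-! ## The annealed exponent of the cover gadget (from the ideator's `Sketch-ideator3.lean`) -/

/-- `x log x` (with Mathlib's `Real.log 0 = 0`, so `xlogx 0 = 0`). -/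
def xlogx (x : ℝ) : ℝ := x * Real.log x

/-- The entropy part of the annealed exponent at a type profile `ν = (ν₀₀, ν₁₀, ν₀₁, ν₁₁)` (types `(s₀, s₁)` =
occupied in layer `0` / layer `1`) and allowed pair-type frequencies, free variables `u = q_{00,10}`, `v = q_{00,01}`
(forced: `q_{10,10} = (ν₁₀-u)/2`, `q_{01,01} = (ν₀₁-v)/2`, `q_{00,11} = ν₁₁`, `q_{00,00} = (ν₀₀-u-v-ν₁₁)/2`;
forbidden pairs `{10,01},{10,11},{01,11},{11,11}`). -/
def coverPsi (ν₀₀ ν₁₀ ν₀₁ ν₁₁ u v : ℝ) : ℝ :=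
  (-(xlogx u + xlogx v + xlogx ν₁₁))
    - (xlogx ((ν₁₀ - u) / 2) + (ν₁₀ - u) / 2 * Real.log 2)
    - (xlogx ((ν₀₁ - v) / 2) + (ν₀₁ - v) / 2 * Real.log 2)
    - (xlogx ((ν₀₀ - u - v - ν₁₁) / 2) + (ν₀₀ - u - v - ν₁₁) / 2 * Real.log 2)

/-- The annealed exponent `Λ_{d,λ}(ν; u, v) = (d-1) Σ_s ν_s log ν_s + (ν₁₀+ν₀₁+2ν₁₁) log λ + d·coverPsi` of
`E_σ Z(cover gadget)` at type profile `ν` and pair profile `(u, v)` (`(1/n') log` of #type assignments × weight ×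
(avoidance probability)^d). -/
def coverLambda (d : ℕ) (lam ν₀₀ ν₁₀ ν₀₁ ν₁₁ u v : ℝ) : ℝ :=
  ((d : ℝ) - 1) * (xlogx ν₀₀ + xlogx ν₁₀ + xlogx ν₀₁ + xlogx ν₁₁)
    + (ν₁₀ + ν₀₁ + 2 * ν₁₁) * Real.log lam
    + (d : ℝ) * coverPsi ν₀₀ ν₁₀ ν₀₁ ν₁₁ u v

/-- Admissible `(ν₁₀, ν₀₁, ν₁₁, u, v)` (`ν₀₀ = 1 - ν₁₀ - ν₀₁ - ν₁₁`): all type and pair frequencies nonnegative. -/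
def Adm (ν₁₀ ν₀₁ ν₁₁ u v : ℝ) : Prop :=
  0 ≤ ν₁₀ ∧ 0 ≤ ν₀₁ ∧ 0 ≤ ν₁₁ ∧ ν₁₀ + ν₀₁ + ν₁₁ ≤ 1 ∧
    0 ≤ u ∧ u ≤ ν₁₀ ∧ 0 ≤ v ∧ v ≤ ν₀₁ ∧ u + v + ν₁₁ ≤ 1 - ν₁₀ - ν₀₁ - ν₁₁

/-- `ℓ_∞`-distance of `(ν₁₀, ν₀₁, ν₁₁, u, v)` to the PRODUCT phase profile with layer densities `(α, β)`
(`ν₁₀ = α(1-β)`, `ν₀₁ = (1-α)β`, `ν₁₁ = αβ`) and pair point `(u₀, v₀)`. -/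
def profDist (α β u₀ v₀ ν₁₀ ν₀₁ ν₁₁ u v : ℝ) : ℝ :=
  max (max |ν₁₀ - α * (1 - β)| |ν₀₁ - (1 - α) * β|) (max |ν₁₁ - α * β| (max |u - u₀| |v - v₀|))

/-- **The variational input of the line (shape of the conclusion of `stub_coverGap`).** The annealed exponent is
maximal on the admissible polytope exactly at the two product phase profiles — layer densities `(p⁺, p⁻)` with
its optimal pair point `(u*, v*)`, and the deck-swapped `(p⁻, p⁺)` with `(v*, u*)` — with a POWER-LAW gap:
`Λ(ν,u,v) + C · min(dist to the one, dist to the other)^ℓ ≤ Λ(ν⁺, u*, v*)`. -/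
def CoverGap (d : ℕ) (lam pp pm : ℝ) : Prop :=
  ∃ us vs : ℝ, Adm (pp * (1 - pm)) ((1 - pp) * pm) (pp * pm) us vs ∧
    ∃ (ℓ : ℕ) (C : ℝ), 0 < C ∧ ∀ ν₁₀ ν₀₁ ν₁₁ u v : ℝ, Adm ν₁₀ ν₀₁ ν₁₁ u v →
      coverLambda d lam (1 - ν₁₀ - ν₀₁ - ν₁₁) ν₁₀ ν₀₁ ν₁₁ u v +
          C * min (profDist pp pm us vs ν₁₀ ν₀₁ ν₁₁ u v) (profDist pm pp vs us ν₁₀ ν₀₁ ν₁₁ u v) ^ ℓ ≤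
        coverLambda d lam ((1 - pp) * (1 - pm)) (pp * (1 - pm)) ((1 - pp) * pm) (pp * pm) us vs

/-! ## The stubs -/

/-- **S1 — the cover gap (HARDEST; the one genuinely new inequality of the line, with its equality case).** For
`d ≥ 3`, `λ > λ_c(𝕋_d)` and the asymmetric critical point `(p⁺, p⁻)` of `Φ₁` (hypotheses verbatim those of the
tree's `slyPhi1_local_gap`): `CoverGap d λ p⁺ p⁻`. Why true: (N1) on product profiles `ν = Bern(α) ⊗ Bern(β)`,
`sup_{u,v} Λ = Φ₁(α,β) = slyPhi1 d λ α β` to `1e-15` (card scratch/ac2.py; TRIAGE-r1-3: 200 random points, 8e-15;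
"almost certainly an exact identity"); (N2) the global maximum of `Λ` over the polytope equals `max Φ₁` and is
attained only at the two product phase profiles — card: 26 `(d, λ)` pairs, `d ≤ 100`, `λ/λ_c ∈ [1.01, 250]`;
TRIAGE-r1-2: independent re-implementation, 84 cases `d ∈ {3,…,100} × λ = λ_c(1+ε)`, `ε ∈ {10⁻³,…,10}`,
violations 0/84, argmax product (`|ν₁₁ - αβ| ≤ 3e-9`), best symmetric profile strictly below (kit j010211);
TRIAGE-r1-3: 15 cases, same. Given (N2) as an exact statement, the power-law form follows from analyticity of `Λ`
in the interior (the maximiser is interior: all `ν_s > 0`, and `u, v` strictly inside by the infinite slope of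
`x log x` at `0`) and the Łojasiewicz inequality / isolated critical points, plus compactness for the uniform part —
exactly how the tree proved `slyPhi1_local_gap` (analyticity + `exists_pow_le_of_analyticAt_of_nonneg`) and
`slyPhi1_uniform_gap`. Route to (N2): for fixed `ν` the inner problem in `(u, v)` is strictly concave with
explicit stationarity `u² = (ν₁₀-u)(ν₀₀-ν₁₁-u-v)`, `v² = (ν₀₁-v)(ν₀₀-ν₁₁-u-v)`; prove (N1) exactly (involution
model = permutation model on product profiles; the `d = 1` shadow is the finite identity `OverlapAveraging` of the
Sketch), then the global statement; do NOT try "Λ ≤ Φ₁(marginals)" pointwise (false at `(3, λ = 44)`,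
`(4, λ = 18.6)` at the symmetric point, TRIAGE-r1-2). Why it might fail: a non-product profile beating
`Φ₁(p⁺,p⁻)` at some untested `(d, λ)` — then the cover gadget is replaced by variant (V1) of the card (two
bipartite copies, two-replica exponent) and only this stub changes. Size L. Leans on: `slyPhi1`,
`slyPhi1_max_triangle`, `slyPhi1_local_gap`, `slyPhi1_uniform_gap`, `sly_criticalPoints` (all PROVED), Mathlib
`AnalyticAt`, `Real.strictConcaveOn_negMulLog`-type lemmas, `IsCompact.exists_isMaxOn`. -/
theorem stub_coverGap {d : ℕ} (hd : 3 ≤ d) {lam pp pm : ℝ} (hlam : hardCoreThreshold d < lam)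
    (hpm : 0 < pm) (hlt : pm < pp) (hsum : pp + pm < 1)
    (hEα : lam * (1 - pp - pm) ^ d = pp * (1 - pp) ^ (d - 1))
    (hEβ : lam * (1 - pp - pm) ^ d = pm * (1 - pm) ^ (d - 1)) :
    CoverGap d lam pp pm := by
  sorry

/-- **S2 — the annealed port law of ONE cover gadget (replaces `(GpropA)` + `(GpropB)` of the Sly gadget;
cover analogue of the tree's PROVED `sly_lemma33`, with a polynomial rate).** For `d ≥ 3`, `λ > λ_c(𝕋_d)`, the
critical densities `(p⁺,p⁻)`, `q^± = p^±/(1-p^∓)`, and the gap of S1: there are `θ₀ > 0` and `n₀` such that for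
every even `n' ≥ n₀`, every `κ` with `2κ ≤ n'^{θ₀}`, every port embedding `P` and port matching `τ`, and EVERY
pattern `k`: `|G(k) - mix(k)·Σ_σ Z| ≤ n'^{-θ₀} · mix(k)·Σ_σ Z`, where `mix = ½(w⁺ + w⁻)` is the mixture of the two
product laws (layer `0` occupied w.p. `q⁺` and layer `1` w.p. `q⁻`, or swapped). Why true: (1) by exchangeability
(the mechanism of `mww_firstMoment` / `card_perm_filter_forall_not_mem`, PROVED) the number of fixed-point-free
involutions avoiding the forbidden pairs depends only on the four type counts, and summed over pair profiles it is
`exp(n'·[Σ_s ν_s log ν_s + coverPsi] + O(log n'))` per matching (Stirling with explicit constants, as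
`abs_log_mwwFirstMoment_sub_le`); with the multinomial and the activity this is `exp(n' coverLambda + O(log n'))`;
the fixed `τ` on the `n' - 2κ` non-ports has the same exponent; (2) `CoverGap` localises the profile sum onto the
`n'^{-1/(2ℓ)}`-windows around the two product phase profiles (as `slyPhi1_offWindow`), symmetric under the deck
swap, hence weights `½, ½`; (3) given the bulk profile, the `m = 4κ` port vertices are a without-replacement sample
— density `e^{±O(m²/(ν_min n'))}` against i.i.d. (`sly_lemma31_abs_log_ratio_sub_le`, `abs_log_choose_sub_le`,
PROVED) — of the tilted single-port law `P(s) ∝ λ^{|s|} e^{(d-1)ψ_s}`, and stationarity of `Λ` at the interior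
maximiser (`-log ν_s + |s| log λ + d ψ_s = const`) gives `P(s) ∝ λ^{|s|/d} ν_s^{(d-1)/d}`: at the product profile
this is the PRODUCT law with layer-0 odds `λ^{1/d}(p⁺/(1-p⁺))^{(d-1)/d} = p⁺/(1-p⁺-p⁻) = q⁺/(1-q⁺)` by the
critical equation `hEα` (checked: `(3, λ=5)` gives `q = 0.7236/0.2764`, the tree two-cycle; TRIAGE-r1-2 and r1-3
re-derived it; independent cavity check by the planner: the double cover gives BOTH cross edges `(p,0)–(u,1)`,
`(p,1)–(u,0)` per matched pair, the annealed cavity map sends `Bern(a) ⊗ Bern(b)` to the product with odds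
`λ(1-b)^{d-1}`, `λ(1-a)^{d-1}`, whose fixed points are exactly the two-cycle equations of
`exists_hardCore_treeTwoCycle`, and a port — a full cavity object of degree `d-1` — has the fixed-point law
`Bern(q⁺) ⊗ Bern(q⁻)` itself), similarly layer 1 with `q⁻`; (4) inside a window the single-port law moves by
`O(n'^{-1/(2ℓ)})`,
so the total relative error is `O(κ n'^{-1/(2ℓ)} + κ²/n') ≤ n'^{-θ₀}` for `θ₀ < 1/(4ℓ)`, `2κ ≤ n'^{θ₀}`.
Degenerate corners: `κ = 0` (one pattern, `mix = 1`, `G = Σ Z`, both sides `0`) ✓. Why it might fail: only through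
S1 (a wrong maximiser location would change the law, not the method). Size L–XL (the tree's `sly_lemma33` for the
bipartite gadget is ~2000 lines; four types and a pair profile here). Leans on: `CoverGap` (S1), `fpfInv`,
`Fintype.piFinset`, `hardcoreZOn`, `sum_hardcoreZOn_fiber`, `log_choose_le_entropy`, `entropy_sub_le_log_choose`,
`abs_log_choose_sub_le`, `sly_lemma31_abs_log_ratio_sub_le`, `slyPhi1_lipschitz_near`-style Lipschitz bounds. -/
theorem stub_annealedPortLaw {d : ℕ} (hd : 3 ≤ d) {lam pp pm qp qm : ℝ} (hlam : hardCoreThreshold d < lam)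
    (hpm : 0 < pm) (hlt : pm < pp) (hsum : pp + pm < 1)
    (hEα : lam * (1 - pp - pm) ^ d = pp * (1 - pp) ^ (d - 1))
    (hEβ : lam * (1 - pp - pm) ^ d = pm * (1 - pm) ^ (d - 1))
    (hqp : qp = pp / (1 - pm)) (hqm : qm = pm / (1 - pp)) (hgap : CoverGap d lam pp pm) :
    ∃ θ₀ : ℝ, 0 < θ₀ ∧ ∃ n₀ : ℕ, ∀ n' : ℕ, n₀ ≤ n' → Even n' →
      ∀ κ : ℕ, (2 * κ : ℝ) ≤ (n' : ℝ) ^ θ₀ →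
        ∀ (P : Fin 2 × Fin κ ↪ Fin n') (τ : Equiv.Perm (Fin n')), IsPortMatching P τ →
          ∀ k : PortPat κ,
            |gadG P τ (d - 1) lam k - mixLaw qp qm k * gadTot τ (d - 1) lam| ≤
              (n' : ℝ) ^ (-θ₀) * (mixLaw qp qm k * gadTot τ (d - 1) lam) := by
  sorry

/-- **S3 — the annealed connector (Sly's Lemma 2.2 for sums over the gadget randomness; the analogue of the
sibling line's `stub_connector`).** If for ONE gadget the annealed port-pattern law is the mixture law up to
relative error `ε ≤ 1` for every pattern, then for EVERY charge vector the annealed partition function of the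
cover-wired graph over a base without half-edges is `C₁ · A_c` up to `(1 ± ε)^{3M}`, with ONE constant
`C₁ > 0` for all charges. Why true: (fibre decomposition, exact) split an independent set of `acGraph R P τ S c`
into its gadget part and its complex part; given the gadget part, the complex part contributes
`Π_{w,j} cxWeight (c w) λ x_{w,j}` with `x_{w,j}(i,a) ∈ {0,1}` the vacancy of the port vertex the end `(w,i,a,j)`
plugs into (`NoFixed`: `canonEnd` is a bijection `Dart ≃ {canonical} × Fin 2`, with `P` injective every port
vertex of a canonical gadget is read by exactly ONE end, `canonEnd_injective`); summing over `S` inside, the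
independent gadgets factor: `Σ_S Z(acGraph S c) = C₀ Σ_{(k_δ)} [Π_{δ canonical} G(k_δ)] Π_{w,j} cxWeight(…)`,
`C₀ = (|GSample| (1+λ)^{2n'})^{#non-canonical darts}`; (substitution) `Π_δ G(k_δ) ∈ (1±ε)^{#canonical} gadTot^{E}
Π_δ mix(k_δ)` termwise (all terms nonnegative, `#canonical ≤ 3M`); (multilinearity) `Π_δ mix(k_δ) =
2^{-E} Σ_{Y on canonical darts} Π_δ prodLaw (Y δ) k_δ`, and under a product law over DISTINCT port vertices
`E[Π_{w,j} cxWeight(c w, λ, x_{w,j})] = Π_{w,j} cxWeight(c w, λ, E x_{w,j}) = (1+λ)^{10Mκ} Π_w cxW λ q⁺ q⁻ (c w)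
(seen R Y w)^κ` since `1 - occP q⁺ q⁻ (seen R Y w (i,a)) = 1 - layerOcc q⁺ q⁻ (Y δ) a` (the sibling line's
`ConnectorFibres` toolkit `sum_bw_*`, LANDED, does exactly this bookkeeping); reading `Y` at all darts instead of
canonical ones multiplies by `2^{#non-canonical}`, charge-independently. Degenerate corners: `M = 0` (`annZ = acA
= 1`), `κ = 0` (no ends plugged; `acA = 2^{3M}·1`), `λ`-independence of nothing: `0 < λ`, `0 < q⁻ < q⁺ < 1` keep
every weight positive. Why it might fail: it cannot in substance (finite algebra), but the bookkeeping is long.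
Size L. Leans on: `hardcoreZOn`, `sum_hardcoreZOn_fiber`, `cxWeight`, `cxW`, `canonEnd_injective`,
`ConnectorFibres.{sum_bw_marginal, sum_bw_prod_split, bw_eq_prod_fib}`, `Finset.prod_add` (Fourier over phases),
`Fintype.piFinset`, `Finset.sum_comm`, `Finset.prod_sum`. -/
theorem stub_annealedConnector (R : RotGraph M 3) (P : Fin 2 × Fin κ ↪ Fin n') (τ : Equiv.Perm (Fin n'))
    (hNF : NoFixed R) (hGS : (GSample n' dm).Nonempty) {lam qp qm ε : ℝ} (hlam : 0 < lam) (hqm : 0 < qm)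
    (hlt : qm < qp) (hqp : qp < 1) (hε0 : 0 ≤ ε) (hε1 : ε ≤ 1)
    (hlaw : ∀ k : PortPat κ, |gadG P τ dm lam k - mixLaw qp qm k * gadTot τ dm lam| ≤
      ε * (mixLaw qp qm k * gadTot τ dm lam)) :
    ∃ C₁ : ℝ, 0 < C₁ ∧ ∀ c : Fin M → ZMod 2,
      (1 - ε) ^ (3 * M) * (C₁ * acA R lam qp qm κ c) ≤ annZ R P τ dm c lam ∧
        annZ R P τ dm c lam ≤ (1 + ε) ^ (3 * M) * (C₁ * acA R lam qp qm κ c) := by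
  sorry

/-- **S4 — the Tseitin sum, exactly (triage r1-2 "first milestone": the tilted factorisation
`A₁/A₀ = (1-T)/(1+T)`, `T = (D/S)^M`).** Over a CONNECTED (edge-expanding) base without half-edges, with
`S = F₀^κ + F₁^κ`, `D = F₀^κ - F₁^κ`, `F_e = cxW e ref`: `A_{1_{w₀}} · (S^M + D^M) = A_0 · (S^M - D^M)`. Why true:
(covariance) flipping the two ends of leg `i` of the complex is the same as adding `1` to its local charge
(`Negative.cxWeight_one_eq` for leg `2`, LANDED; legs `0, 1` by the inner relabelling `S' ↦ S' + eᵢ`), so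
`cxW e (seen R Y w) = cxW (e + #{i : Y(canonEnd(w,i).1) = false}) ref` for all real parameters; (Fourier) write
`f(u) = (S + (-1)^u D)/2`, expand `Π_w f(c w + n_w(Y)) = 2^{-M} Σ_{U ⊆ Fin M} S^{M-|U|} D^{|U|} (-1)^{Σ_U (c + n(Y))}`;
`NoFixed` makes the two darts of an edge read the same canonical bit, so `Σ_{w ∈ U} n_w(Y) ≡ Σ_{e ∈ ∂U} [¬Y e]`
and the sum over `Y` kills every `U` with `∂U ≠ ∅`; `EdgeExpansion` (`η > 0`, `expand` on the smaller side) makes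
`∂U = ∅ ⇔ U ∈ {∅, univ}`; hence `A_c = 2^{2M} (S^M + (-1)^{Σ c} D^M)` and the identity. No positivity needed (a
polynomial identity in `λ, q±`). Degenerate corners: `κ = 0` (`S = 2`, `D = 0`, `A₁ = A₀`) ✓, `M = 1` ✓. Why it
might fail: it cannot (exact algebra; the sibling identity was re-derived by both triagers and the disprover).
Size M. Leans on: `cxW`, `pwPsi`'s reference pattern, `Negative.cxWeight_one_eq`, `canonEnd`, `NoFixed`,
`EdgeExpansion.expand`, `Finset.prod_add`, `Finset.sum_comm`, `ZMod 2` parity bookkeeping of `CFIMatching`. -/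
theorem stub_tseitinSum {R : RotGraph M 3} {η : ℝ} (hR : EdgeExpansion R η) (hNF : NoFixed R)
    (lam qp qm : ℝ) (κ : ℕ) (w₀ : Fin M) :
    acA R lam qp qm κ (Pi.single w₀ 1) *
        ((cxF lam qp qm κ 0 + cxF lam qp qm κ 1) ^ M + (cxF lam qp qm κ 0 - cxF lam qp qm κ 1) ^ M) =
      acA R lam qp qm κ 0 *
        ((cxF lam qp qm κ 0 + cxF lam qp qm κ 1) ^ M - (cxF lam qp qm κ 0 - cxF lam qp qm κ 1) ^ M) := by
  sorry

/-- **S5 — Duplicator, samplewise (CFI gauge + local consistency; the LANDED `ParityWiredPorts.stub_duplicator`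
mutatis mutandis).** Over an `η`-edge-expander on `M ≥ 2` vertices, for EVERY gadget sample `S`, any two charge
vectors give `≡_{C^K}`-equivalent cover-wired graphs when `6K < ηM`. Why true: for `g : Dart → ZMod 2` constant on
edges the shift `(δ,a,x) ↦ (δ,a+g δ,x)`, `(w,i,a,j) ↦ (w,i,a+g(w,i),j)`, `(w,S',j) ↦ (w,S'+g|_w,j)` is an isomorphism
`acGraph c ≅ acGraph (c + ∂g)` for every `S` — the gadget clause is invariant because the deck involution
`a ↦ a + 1` is an automorphism of every cover gadget (`Sketch.coverCore_swap`), the end clause because both darts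
of an edge carry the same `g`, the inner clause by `CFIMatching.bit_shift` — adjacency reads `c` only at inner
vertices and every vertex needs `≤ 2·3` darts (`pneed`), so the positions "pebbled pairs `(x, shift g x)` with
admissible `(D, g)`, `LocCons R (c + c')`" and the patchwork bijection win, verbatim as in
`PhaseTwinsPolyDepthTwinsAboveDuplicator.lean` (387 lines, LANDED). Why it might fail: it cannot (same proof;
`S` is never touched by the shift). Size M. Leans on: `TseitinColouring.{DAdm, LocCons, extend_many,
constraint_of_blocked, locCons_empty, dAdm_empty, EdgeExpansion}`, `CFIMatching.{bit_shift, Canon}`, `CkEquiv`,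
`BijPebbleStrategy`, the `pshift/pneed/PNeed` toolkit of the landed Duplicator file. -/
theorem stub_duplicator {R : RotGraph M 3} {η : ℝ} (hR : EdgeExpansion R η) (hM : 2 ≤ M)
    (P : Fin 2 × Fin κ ↪ Fin n') (τ : Equiv.Perm (Fin n')) (S : Dart M 3 → Fin dm → Equiv.Perm (Fin n'))
    (c c' : Fin M → ZMod 2) {K : ℕ} (hK : (2 * 3 * K : ℝ) < η * M) :
    CkEquiv K (acGraph R P τ S c) (acGraph R P τ S c') := by
  sorry

/-- **S7 — the parameter regime is nonempty (asymptotic arithmetic).** Given the port-law exponent `θ₀ > 0`, the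
expansion `η > 0` and the two complex factors `0 < F₁ < F₀`: with `k` large (`k θ₀ > 1`), `θ' = 1/(2k+2)`,
`M = m₀·2(D+1)`, `n' = 2M^k`, `κ = ⌈log(4M)/log(F₀/F₁)⌉`, `K = ⌊ηM/7⌋`, for all `m₀` beyond a threshold:
`N₀ ≤ M`, `n₀ ≤ n'`, `κ ≤ M^k`, `2κ ≤ n'^{θ₀}`, `(F₀^κ+F₁^κ)^M ≤ 2(F₀^κ-F₁^κ)^M` (as `(F₁/F₀)^κ ≤ 1/(4M)`:
`(1+r)^M ≤ e^{1/4} < 3/2 ≤ 2(1 - Mr) ≤ 2(1-r)^M`), `2(1+ε)^{3M} ≤ 3(1-ε)^{3M}` for `ε = n'^{-θ₀} ≤ 2^{-θ₀} M^{-kθ₀}`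
(`3Mε → 0`), `ε ≤ 1`, `6K < ηM`, `2 ≤ M`, `1 ≤ K`, and `(6Mn' + 10Mκ)^{θ'} ≤ (22 M^{k+1})^{θ'} ≤ √22 √M ≤ K`. Why
it might fail: it cannot (bookkeeping), but it fixes the crux exponent `θ'(θ₀)`. Size M (rpow/log/floor/ceil
asymptotics in the style of the sibling `stub_parameters`, `eventually_mul_rpow_rpow_le_slyB_pow`,
`CountingWidthProofs.dc_mul_le_Kn`). Leans on: `Real.rpow_natCast`, `Real.add_pow_le_pow_mul_pow_of_sq_le_sq`,
`Real.add_one_le_exp`, `one_add_mul_le_pow`, `Nat.le_ceil`, `Nat.floor_le`, `Real.log_le_sub_one_of_pos`,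
`tendsto_pow_mul_exp_neg_atTop_nhds_zero`-type limits. -/
theorem stub_parameters {θ₀ η F0 F1 : ℝ} (hθ₀ : 0 < θ₀) (hη : 0 < η) (hF1 : 0 < F1) (hF : F1 < F0)
    (D n₀ : ℕ) :
    ∃ θ' : ℝ, 0 < θ' ∧ ∃ k : ℕ, 1 ≤ k ∧ ∀ N₀ : ℕ, ∃ m₁ : ℕ, ∀ m₀ : ℕ, m₁ ≤ m₀ →
      ∀ M n' κ K : ℕ, M = m₀ * 2 * (D + 1) → n' = 2 * M ^ k →
        κ = ⌈Real.log (4 * (M : ℝ)) / Real.log (F0 / F1)⌉₊ → K = ⌊η * M / 7⌋₊ →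
          N₀ ≤ M ∧ n₀ ≤ n' ∧ κ ≤ M ^ k ∧
          (2 * κ : ℝ) ≤ (n' : ℝ) ^ θ₀ ∧
          (F0 ^ κ + F1 ^ κ) ^ M ≤ 2 * (F0 ^ κ - F1 ^ κ) ^ M ∧
          2 * (1 + (n' : ℝ) ^ (-θ₀)) ^ (3 * M) ≤ 3 * (1 - (n' : ℝ) ^ (-θ₀)) ^ (3 * M) ∧
          (n' : ℝ) ^ (-θ₀) ≤ 1 ∧
          (2 * 3 * K : ℝ) < η * M ∧ 2 ≤ M ∧ 1 ≤ K ∧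
          (((6 * M * n' + 10 * M * κ : ℕ) : ℝ)) ^ θ' ≤ K := by
  sorry

/-! ## The degree bound, samplewise (PROVED: `maxDegree_acGraph`; it was the seventh stub of the first check) -/

/-- Adjacency of the cover-wired graph: the symmetrised, irreflexive closure of `acRel`. -/
theorem acGraph_adj (R : RotGraph M 3) (P : Fin 2 × Fin κ ↪ Fin n') (τ : Equiv.Perm (Fin n'))
    (S : Dart M 3 → Fin dm → Equiv.Perm (Fin n')) (c : Fin M → ZMod 2) (x y : PWVert M n' κ) :
    (acGraph R P τ S c).Adj x y ↔ x ≠ y ∧ (acRel R P τ S c x y ∨ acRel R P τ S c y x) :=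
  SimpleGraph.fromRel_adj _ _ _

/-- The neighbours of a gadget vertex `(δ, a, x)`: a vertex `(δ, a + 1, y')` of the other layer matched to `x` by
some `S δ i` or by `τ` (in either orientation), or an end `(w, i, a, j)` plugged into `x = P (s, j)` with
`canonEnd R (w, i) = (δ, s)`. -/
theorem adj_gad {R : RotGraph M 3} {P : Fin 2 × Fin κ ↪ Fin n'} {τ : Equiv.Perm (Fin n')}
    {S : Dart M 3 → Fin dm → Equiv.Perm (Fin n')} {c : Fin M → ZMod 2} {δ : Dart M 3} {a : ZMod 2}
    {x : Fin n'} {y : PWVert M n' κ} (h : (acGraph R P τ S c).Adj (Sum.inl (δ, a, x)) y) :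
    (∃ y' : Fin n', y = Sum.inl (δ, a + 1, y') ∧ x ≠ y' ∧
        ((∃ i, S δ i x = y' ∨ S δ i y' = x) ∨ τ x = y' ∨ τ y' = x)) ∨
    (∃ (w : Fin M) (i : Fin 3) (j : Fin κ), y = Sum.inr (Sum.inl (w, i, a, j)) ∧
        δ = (canonEnd R (w, i)).1 ∧ x = P ((canonEnd R (w, i)).2, j)) := by
  rw [acGraph_adj] at h
  obtain ⟨-, h⟩ := h
  rcases y with ⟨δ', b, y'⟩ | ⟨w, i, a', j⟩ | ⟨w, S', j⟩
  · simp only [acRel] at h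
    rcases h with ⟨-, rfl, rfl, hne, hh⟩ | ⟨-, rfl, hab, hne, hh⟩
    · refine Or.inl ⟨y', rfl, hne, ?_⟩
      rcases hh with ⟨i, hi⟩ | hτ
      · exact Or.inl ⟨i, Or.inl hi⟩
      · exact Or.inr (Or.inl hτ)
    · have hb : b = a + 1 := by rw [hab, add_assoc, zmod2_add_self, add_zero]
      refine Or.inl ⟨y', by rw [hb], fun h => hne h.symm, ?_⟩
      rcases hh with ⟨i, hi⟩ | hτ
      · exact Or.inl ⟨i, Or.inr hi⟩
      · exact Or.inr (Or.inr hτ)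
  · simp only [acRel, false_or] at h
    obtain ⟨rfl, hδ, hx⟩ := h
    exact Or.inr ⟨w, i, j, rfl, hδ, hx⟩
  · simp only [acRel, or_self] at h

/-- **Gadget vertices have degree `≤ dm + 1`**: the `dm` matched partners `(δ, a+1, S δ i x)`, plus at most ONE
further neighbour — the `τ`-partner if `x` is not a port, the unique plugged end if it is. -/
theorem degree_gad_le (R : RotGraph M 3) (P : Fin 2 × Fin κ ↪ Fin n') {τ : Equiv.Perm (Fin n')}
    (hτ : IsPortMatching P τ) {S : Dart M 3 → Fin dm → Equiv.Perm (Fin n')}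
    (hS : ∀ δ i, S δ i ∈ fpfInv (Fin n')) (c : Fin M → ZMod 2) (δ : Dart M 3) (a : ZMod 2) (x : Fin n') :
    (acGraph R P τ S c).degree (Sum.inl (δ, a, x)) ≤ dm + 1 := by
  have hSinv : ∀ δ i y, S δ i (S δ i y) = y := by
    intro δ i y
    have h := hS δ i
    simp only [fpfInv, Finset.mem_filter, Finset.mem_univ, true_and] at h
    exact h.1 y
  set A : Finset (PWVert M n' κ) :=
    (univ : Finset (Fin dm)).image fun i => Sum.inl (δ, a + 1, S δ i x) with hA
  set N : Finset (PWVert M n' κ) := (acGraph R P τ S c).neighborFinset (Sum.inl (δ, a, x)) with hN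
  have hAcard : A.card ≤ dm := card_image_le.trans (by rw [card_univ, Fintype.card_fin])
  -- the further neighbours: the `τ`-partner (only off the ports) or a plugged end (only at a port)
  have hout : ∀ y ∈ N \ A, (y = Sum.inl (δ, a + 1, τ x) ∧ τ x ≠ x) ∨
      (∃ (w : Fin M) (i : Fin 3) (j : Fin κ), y = Sum.inr (Sum.inl (w, i, a, j)) ∧
        δ = (canonEnd R (w, i)).1 ∧ x = P ((canonEnd R (w, i)).2, j)) := by
    intro y hy
    rw [mem_sdiff, hN, SimpleGraph.mem_neighborFinset] at hy
    rcases adj_gad hy.1 with ⟨y', rfl, hne, hh⟩ | h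
    · rcases hh with ⟨i, hi⟩ | hτx | hτy
      · exfalso
        apply hy.2
        have hy' : y' = S δ i x := by
          rcases hi with hi | hi
          · exact hi.symm
          · rw [← hi, hSinv]
        rw [hy', hA]
        exact mem_image.2 ⟨i, mem_univ _, rfl⟩
      · exact Or.inl ⟨by rw [hτx], fun h => hne (h.symm.trans hτx)⟩
      · have hy' : y' = τ x := by rw [← hτy, hτ.invol]
        exact Or.inl ⟨by rw [hy'], fun h => hne (by rw [hy', h])⟩
    · exact Or.inr h
  -- hence at most one of them
  have hcard : (N \ A).card ≤ 1 := by
    refine card_le_one.2 fun y hy y' hy' => ?_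
    rcases hout y hy with ⟨rfl, hx⟩ | ⟨w, i, j, rfl, hδ, hx⟩ <;>
      rcases hout y' hy' with ⟨rfl, hx'⟩ | ⟨w', i', j', rfl, hδ', hx'⟩
    · rfl
    · exact absurd ((hτ.fixed_iff x).2 ⟨_, hx'.symm⟩) hx
    · exact absurd ((hτ.fixed_iff x).2 ⟨_, hx.symm⟩) hx'
    · -- two ends plugged into `x`: same slot (`P` injective), hence the same dart (`canonEnd` injective)
      have hk := P.injective (hx.symm.trans hx')
      simp only [Prod.mk.injEq] at hk
      have hwi := canonEnd_injective R (Prod.ext (hδ.symm.trans hδ') hk.1)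
      simp only [Prod.mk.injEq] at hwi
      obtain ⟨rfl, rfl⟩ := hwi
      rw [hk.2]
  calc (acGraph R P τ S c).degree (Sum.inl (δ, a, x)) = N.card :=
        (SimpleGraph.card_neighborFinset_eq_degree _ _).symm
    _ ≤ (N \ A).card + A.card := card_le_card_sdiff_add_card
    _ ≤ 1 + dm := add_le_add hcard hAcard
    _ = dm + 1 := add_comm _ _

/-- **End vertices have degree `≤ 3`**: the port vertex the end plugs into, and the inner vertices `(w, S', j)`
with `bit (c w) S' i = a` (at most two, `card_filter_bit_le`, LANDED). -/
theorem degree_end_le (R : RotGraph M 3) (P : Fin 2 × Fin κ ↪ Fin n') (τ : Equiv.Perm (Fin n'))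
    (S : Dart M 3 → Fin dm → Equiv.Perm (Fin n')) (c : Fin M → ZMod 2) (w : Fin M) (i : Fin 3)
    (a : ZMod 2) (j : Fin κ) : (acGraph R P τ S c).degree (Sum.inr (Sum.inl (w, i, a, j))) ≤ 3 := by
  set C : PWVert M n' κ := Sum.inl ((canonEnd R (w, i)).1, a, P ((canonEnd R (w, i)).2, j)) with hC
  set I : Finset (PWVert M n' κ) :=
    ((univ : Finset (Fin 2 → ZMod 2)).filter fun S' => bit (c w) S' i = a).image
      fun S' => Sum.inr (Sum.inr (w, S', j)) with hI
  have hsub : (acGraph R P τ S c).neighborFinset (Sum.inr (Sum.inl (w, i, a, j))) ⊆ insert C I := by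
    intro y hy
    rw [SimpleGraph.mem_neighborFinset, acGraph_adj] at hy
    obtain ⟨-, hy⟩ := hy
    rcases y with ⟨δ', a', y'⟩ | ⟨w', i', a', j'⟩ | ⟨w', S', j'⟩
    · simp only [acRel, or_false] at hy
      obtain ⟨ha, hδ, hy'⟩ := hy
      rw [ha, hδ, hy']
      exact mem_insert_self _ _
    · simp only [acRel, or_self] at hy
    · simp only [acRel, false_or] at hy
      obtain ⟨hw, hj, hb⟩ := hy
      rw [← hw, ← hj]
      rw [← hw] at hb
      exact mem_insert_of_mem (mem_image.2 ⟨S', mem_filter.2 ⟨mem_univ _, hb⟩, rfl⟩)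
  have hIcard : I.card ≤ 2 := card_image_le.trans (card_filter_bit_le (c w) a i)
  calc (acGraph R P τ S c).degree (Sum.inr (Sum.inl (w, i, a, j)))
      = ((acGraph R P τ S c).neighborFinset (Sum.inr (Sum.inl (w, i, a, j)))).card :=
        (SimpleGraph.card_neighborFinset_eq_degree _ _).symm
    _ ≤ (insert C I).card := card_le_card hsub
    _ ≤ I.card + 1 := card_insert_le _ _
    _ ≤ 3 := by omega

/-- **Inner vertices have degree `≤ 3`**: the only neighbours of `(w, S', j)` are the three ends
`(w, i, bit (c w) S' i, j)`. -/
theorem degree_inner_le (R : RotGraph M 3) (P : Fin 2 × Fin κ ↪ Fin n') (τ : Equiv.Perm (Fin n'))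
    (S : Dart M 3 → Fin dm → Equiv.Perm (Fin n')) (c : Fin M → ZMod 2) (w : Fin M)
    (S' : Fin 2 → ZMod 2) (j : Fin κ) : (acGraph R P τ S c).degree (Sum.inr (Sum.inr (w, S', j))) ≤ 3 := by
  set E : Finset (PWVert M n' κ) :=
    (univ : Finset (Fin 3)).image fun i => Sum.inr (Sum.inl (w, i, bit (c w) S' i, j)) with hE
  have hsub : (acGraph R P τ S c).neighborFinset (Sum.inr (Sum.inr (w, S', j))) ⊆ E := by
    intro y hy
    rw [SimpleGraph.mem_neighborFinset, acGraph_adj] at hy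
    obtain ⟨-, hy⟩ := hy
    rcases y with ⟨δ', a', y'⟩ | ⟨w', i', a', j'⟩ | ⟨w', S'', j'⟩
    · simp only [acRel, or_self] at hy
    · simp only [acRel, or_false] at hy
      obtain ⟨hw, hj, hb⟩ := hy
      rw [hw, hj, ← hb]
      exact mem_image.2 ⟨i', mem_univ _, rfl⟩
    · simp only [acRel, or_self] at hy
  calc (acGraph R P τ S c).degree (Sum.inr (Sum.inr (w, S', j)))
      = ((acGraph R P τ S c).neighborFinset (Sum.inr (Sum.inr (w, S', j)))).card :=
        (SimpleGraph.card_neighborFinset_eq_degree _ _).symm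
    _ ≤ E.card := card_le_card hsub
    _ ≤ (univ : Finset (Fin 3)).card := card_image_le
    _ = 3 := by rw [card_univ, Fintype.card_fin]

/-- **Degree bound, samplewise (PROVED; formerly stub S6).** If every `S δ i` is a fixed-point-free involution
and `τ` a port matching, `acGraph R P τ S c` has maximum degree `≤ dm + 1` (`= d = Δ`) provided `3 ≤ dm + 1`: gadget vertices by
`degree_gad_le` (`dm` matched partners plus at most one of {`τ`-partner, plugged end} — the hypothesis
`IsPortMatching` is load-bearing: a `τ` moving a port would give it degree `dm + 2`), ends by `degree_end_le`,
inner vertices by `degree_inner_le`. -/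
theorem maxDegree_acGraph (hdm : 3 ≤ dm + 1) (R : RotGraph M 3) (P : Fin 2 × Fin κ ↪ Fin n')
    {τ : Equiv.Perm (Fin n')} (hτ : IsPortMatching P τ) {S : Dart M 3 → Fin dm → Equiv.Perm (Fin n')}
    (hS : ∀ δ i, S δ i ∈ fpfInv (Fin n')) (c : Fin M → ZMod 2) :
    (acGraph R P τ S c).maxDegree ≤ dm + 1 := by
  refine SimpleGraph.maxDegree_le_of_forall_degree_le _ _ fun z => ?_
  rcases z with ⟨δ, a, x⟩ | ⟨w, i, a, j⟩ | ⟨w, S', j⟩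
  · exact degree_gad_le R P hτ hS c δ a x
  · exact (degree_end_le R P τ S c w i a j).trans hdm
  · exact (degree_inner_le R P τ S c w S' j).trans hdm

/-! ## Proved glue -/

/-- **The lever (averaging principle, from the ideator's Sketch).** A first-moment inequality over a finite
nonempty family of samples already produces ONE sample with the twin inequality — no second moment, no
concentration, no typical gadget. -/
theorem exists_twin_of_sum_le {ι : Type*} (s : Finset ι) (hs : s.Nonempty) (Z₀ Z₁ : ι → ℝ)
    (h : 2 * ∑ r ∈ s, Z₁ r ≤ ∑ r ∈ s, Z₀ r) : ∃ r ∈ s, 2 * Z₁ r ≤ Z₀ r := by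
  by_contra hcon
  push Not at hcon
  have hlt : ∑ r ∈ s, Z₀ r < ∑ r ∈ s, 2 * Z₁ r :=
    Finset.sum_lt_sum_of_nonempty hs (fun r hr => hcon r hr)
  rw [← Finset.mul_sum] at hlt
  linarith

/-- `Fin 2` has no `rev`-fixed point. -/
theorem fin2_rev_ne (s : Fin 2) : s.rev ≠ s := by
  revert s; decide

/-- The layer flip `(s, u) ↦ (s.rev, u)` on `Fin 2 × Fin L`, transported to `Fin (2L)`, is a fixed-point-free
involution: the gadget sample space is nonempty for even `n'`. -/
theorem gsample_nonempty (L dm : ℕ) : (GSample (2 * L) dm).Nonempty := by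
  let e : Fin 2 × Fin L ≃ Fin (2 * L) := finProdFinEquiv
  let f : Fin 2 × Fin L → Fin 2 × Fin L := fun p => (p.1.rev, p.2)
  have hf : Function.Involutive f := fun p => by simp [f, Fin.rev_rev]
  let σ₀ : Equiv.Perm (Fin (2 * L)) := e.permCongr (hf.toPerm f)
  have hσ₀ : σ₀ ∈ fpfInv (Fin (2 * L)) := by
    simp only [fpfInv, Finset.mem_filter, Finset.mem_univ, true_and]
    refine ⟨fun x => ?_, fun x => ?_⟩
    · simp only [σ₀, Equiv.permCongr_apply, Equiv.symm_apply_apply]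
      show e (f (f (e.symm x))) = x
      rw [hf, Equiv.apply_symm_apply]
    · simp only [σ₀, Equiv.permCongr_apply]
      show e (f (e.symm x)) ≠ x
      intro h
      have h' : f (e.symm x) = e.symm x := by
        apply e.injective; rw [h, Equiv.apply_symm_apply]
      exact fin2_rev_ne _ (congrArg Prod.fst h')
  exact ⟨fun _ => σ₀, Fintype.mem_piFinset.2 fun _ => hσ₀⟩

/-- **Ports and a port matching exist** on `Fin (2L)` for `κ ≤ L`: ports `(s, j) ↦ (s, j)`, and `τ` the layer
flip `(s, u) ↦ (s.rev, u)` on the non-port columns `u ≥ κ`, the identity on the port columns. -/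
theorem exists_portMatching {L κ : ℕ} (hκ : κ ≤ L) :
    ∃ (P : Fin 2 × Fin κ ↪ Fin (2 * L)) (τ : Equiv.Perm (Fin (2 * L))), IsPortMatching P τ := by
  let e : Fin 2 × Fin L ≃ Fin (2 * L) := finProdFinEquiv
  let f : Fin 2 × Fin L → Fin 2 × Fin L := fun p => (if κ ≤ (p.2 : ℕ) then p.1.rev else p.1, p.2)
  have hf : Function.Involutive f := by
    rintro ⟨s, u⟩
    by_cases h : κ ≤ (u : ℕ)
    · simp [f, h, Fin.rev_rev]
    · simp [f, h]
  let P' : Fin 2 × Fin κ ↪ Fin 2 × Fin L :=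
    ⟨fun q => (q.1, Fin.castLE hκ q.2), fun q q' h => by
      simp only [Prod.mk.injEq] at h
      exact Prod.ext h.1 (Fin.castLE_injective hκ h.2)⟩
  have hfix : ∀ p : Fin 2 × Fin L, f p = p ↔ p ∈ Set.range P' := by
    rintro ⟨s, u⟩
    constructor
    · intro h
      by_cases hu : κ ≤ (u : ℕ)
      · simp only [f, hu, if_true, Prod.mk.injEq, and_true] at h
        exact absurd h (fin2_rev_ne s)
      · push Not at hu
        exact ⟨(s, ⟨u, hu⟩), rfl⟩
    · rintro ⟨⟨s', j⟩, hq⟩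
      simp only [P', Function.Embedding.coeFn_mk, Prod.mk.injEq] at hq
      obtain ⟨rfl, rfl⟩ := hq
      have hj : ¬ κ ≤ ((Fin.castLE hκ j : Fin L) : ℕ) := by
        simp only [Fin.val_castLE, not_le]; exact j.isLt
      simp only [f, hj, if_false]
  refine ⟨P'.trans e.toEmbedding, e.permCongr (hf.toPerm f), ⟨fun x => ?_, fun x => ?_⟩⟩
  · simp only [Equiv.permCongr_apply, Equiv.symm_apply_apply]
    show e (f (f (e.symm x))) = x
    rw [hf, Equiv.apply_symm_apply]
  · simp only [Equiv.permCongr_apply]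
    show e (f (e.symm x)) = x ↔ x ∈ Set.range (P'.trans e.toEmbedding)
    constructor
    · intro h
      have h' : f (e.symm x) = e.symm x := by
        apply e.injective; rw [h, Equiv.apply_symm_apply]
      obtain ⟨q, hq⟩ := (hfix _).1 h'
      exact ⟨q, by simp [Function.Embedding.trans_apply, hq]⟩
    · rintro ⟨q, rfl⟩
      have h' : f (P' q) = P' q := (hfix _).2 ⟨q, rfl⟩
      simp [Function.Embedding.trans_apply, h']

/-- **Deck symmetry, samplewise** (the ideator's `coverCore_swap`): the layer swap `(a, x) ↦ (a + 1, x)` is an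
automorphism of EVERY cover gadget — the fact that lets one gadget per edge carry the CFI torsor (S5) and makes the
two phases of the annealed law exactly equiprobable (S2, S4). -/
theorem gadGraph_adj_swap (τ : Equiv.Perm (Fin n')) (σ : Fin dm → Equiv.Perm (Fin n')) (a b : ZMod 2)
    (x y : Fin n') : (gadGraph τ σ).Adj (a + 1, x) (b + 1, y) ↔ (gadGraph τ σ).Adj (a, x) (b, y) := by
  simp only [gadGraph, SimpleGraph.fromRel_adj, gadRel, ne_eq, Prod.mk.injEq, add_left_inj]

/-- The main term is nonnegative (`λ ≥ 0`, `q± ≤ 1`). -/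
theorem acA_nonneg (R : RotGraph M 3) {lam qp qm : ℝ} (hlam : 0 ≤ lam) (hqm1 : qm ≤ 1) (hqp1 : qp ≤ 1)
    (κ : ℕ) (c : Fin M → ZMod 2) : 0 ≤ acA R lam qp qm κ c :=
  Finset.sum_nonneg fun Y _ => Finset.prod_nonneg fun w _ =>
    pow_nonneg (cxW_pos hlam hqm1 hqp1 (c w) (seen R Y w)).le κ

/-- From the Tseitin identity and `S^M ≤ 2 D^M`: `3 A₁ ≤ A₀`. -/
theorem acA_odd_le_third {A0 A1 S D : ℝ} (hA0 : 0 ≤ A0) (hS : 0 < S) (hD : 0 ≤ D)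
    (hid : A1 * (S + D) = A0 * (S - D)) (hSD : S ≤ 2 * D) : 3 * A1 ≤ A0 := by
  have hpos : 0 < S + D := by linarith
  have h1 : 3 * A1 * (S + D) = 3 * (A0 * (S - D)) := by rw [← hid]; ring
  have h2 : 3 * (A0 * (S - D)) ≤ A0 * (S + D) := by
    nlinarith [mul_nonneg hA0 (by linarith : (0 : ℝ) ≤ 2 * D - S)]
  have h3 : 3 * A1 * (S + D) ≤ A0 * (S + D) := by rw [h1]; exact h2
  exact le_of_mul_le_mul_right h3 hpos

/-- The independence polynomial is invariant under transport along a bijection of the vertices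
(from the sibling skeleton). -/
theorem independencePolynomial_map_equiv {α β : Type*} [Fintype α] [DecidableEq α] [Fintype β]
    [DecidableEq β] (G : SimpleGraph α) (e : α ≃ β) (lam : ℝ) :
    independencePolynomial (G.map e.toEmbedding) lam = independencePolynomial G lam := by
  have hadj : ∀ a b : α, (G.map e.toEmbedding).Adj (e.toEmbedding a) (e.toEmbedding b) ↔ G.Adj a b :=
    fun a b => SimpleGraph.map_adj_apply
  have hind : ∀ I : Finset α,
      (G.map e.toEmbedding).IsIndepSet (↑(I.map e.toEmbedding) : Set β) ↔ G.IsIndepSet (↑I : Set α) := by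
    intro I
    constructor
    · intro h a ha b hb hab
      have hab' : e.toEmbedding a ≠ e.toEmbedding b := fun h' => hab (e.injective h')
      have := h (Finset.mem_coe.2 (Finset.mem_map_of_mem _ (Finset.mem_coe.1 ha)))
        (Finset.mem_coe.2 (Finset.mem_map_of_mem _ (Finset.mem_coe.1 hb))) hab'
      exact fun hG => this ((hadj a b).2 hG)
    · intro h x hx y hy hxy
      obtain ⟨a, ha, rfl⟩ := Finset.mem_map.1 (Finset.mem_coe.1 hx)
      obtain ⟨b, hb, rfl⟩ := Finset.mem_map.1 (Finset.mem_coe.1 hy)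
      exact fun hG => h (Finset.mem_coe.2 ha) (Finset.mem_coe.2 hb) (fun hab => hxy (by rw [hab]))
        ((hadj a b).1 hG)
  unfold independencePolynomial
  symm
  refine Fintype.sum_equiv (Equiv.finsetCongr e) _ _ fun I => ?_
  rw [Equiv.finsetCongr_apply, Finset.card_map]
  by_cases hI : G.IsIndepSet (↑I : Set α)
  · rw [if_pos hI, if_pos ((hind I).2 hI)]
  · rw [if_neg hI, if_neg (fun h => hI ((hind I).1 h))]

/-- Transport of a degree bound along an isomorphism, for ANY decidability instances (from the sibling skeleton). -/
theorem maxDegree_le_of_iso {α β : Type*} [Fintype α] [Fintype β] {G : SimpleGraph α} {H : SimpleGraph β}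
    {iG : DecidableRel G.Adj} {iH : DecidableRel H.Adj} (f : G ≃g H) {Δ : ℕ}
    (h : @SimpleGraph.maxDegree α G _ iG ≤ Δ) : @SimpleGraph.maxDegree β H _ iH ≤ Δ := by
  have := f.maxDegree_eq
  rw [← this]; exact h

/-- The route's inlined sum IS `independencePolynomial`, for ANY decidability instances (from the sibling skeleton). -/
theorem indepSum_eq {α : Type*} [Fintype α] [DecidableEq α] (G : SimpleGraph α) {iG : DecidableRel G.Adj}
    {dI : ∀ I : Finset α, Decidable (G.IsIndepSet (↑I : Set α))} (lam : ℝ) :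
    (∑ I : Finset α, @ite ℝ (G.IsIndepSet (↑I : Set α)) (dI I) (lam ^ I.card) 0) =
      @independencePolynomial α _ _ G iG ℝ _ lam := by
  unfold independencePolynomial
  exact Finset.sum_congr rfl fun I _ => by congr

/-- The number of vertices (from the sibling skeleton): `|PWVert M n' κ| = 6 M n' + 10 M κ`. -/
theorem card_PWVert (M v κ₂ : ℕ) : Fintype.card (PWVert M v κ₂) = 6 * M * v + 10 * M * κ₂ := by
  simp only [PWVert, Fintype.card_sum, Fintype.card_prod, Fintype.card_fin, ZMod.card, Fintype.card_fun]
  ring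

/-! ## The composition (kernel-checked, no `sorry` of its own) -/

/-- **`PolyDepthTwinsAbove` from the six stubs (and the proved degree bound).** Given `Δ ≥ 3` and `λ > λ_c(Δ)`: the tree gives the critical
densities `(p⁺,p⁻)` and `0 < q⁻ < q⁺ < 1` (`exists_slyCriticalDensities`); S1 the cover gap; S2 the port-law
exponent `θ₀` and threshold `n₀`; charge visibility `0 < F₁ < F₀` is LANDED (`cxWeight_zero_sub_one_ref`,
`cxWeight_one_ref_pos`); S7 fixes `θ'` and, for every `N₀`, the parameters `M, n' = 2M^k, κ, K`; the base is
`base3 (zigzagParams.R m₁)` (`η₃`-edge-expander, no half-edges, PROVED); ports and the port matching exist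
(`exists_portMatching`), the sample space is nonempty (`gsample_nonempty`); S2 ⇒ S3 gives the two-sided
`(1±ε)^{3M} C₁ A_c` estimates, S4 + `acA_odd_le_third` give `3A₁ ≤ A₀`, S7's error budget closes
`2·annZ(1_{w₀}) ≤ annZ(0)`; `exists_twin_of_sum_le` picks ONE sample `S*`; `maxDegree_acGraph` (degrees, PROVED)
and S5 (`≡_{C^K}`) hold for `S*` as for every sample; transport to `Fin N` and the PROVED Dvořák bridge finish exactly as in the sibling
composition. -/
theorem PolyDepthTwinsAbove_of : PolyDepthTwinsAbove := by
  intro Δ hΔ lam hlam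
  have hlam' : hardCoreThreshold Δ < lam := hlam
  have hlam0 : 0 < lam := (hardCoreThreshold_pos hΔ).trans hlam'
  obtain ⟨pp, pm, qp, qm, hpm, hlt, hsum, hEα, hEβ, hqm, hqlt, hqp1, hqp_eq, hqm_eq, -, -⟩ :=
    exists_slyCriticalDensities hΔ hlam'
  -- S1 and S2
  have hgap : CoverGap Δ lam pp pm := stub_coverGap hΔ hlam' hpm hlt hsum hEα hEβ
  obtain ⟨θ₀, hθ₀, n₀, hS2⟩ := stub_annealedPortLaw hΔ hlam' hpm hlt hsum hEα hEβ hqp_eq hqm_eq hgap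
  -- charge visibility (LANDED): `0 < F₁ < F₀`
  have h10 : (0 : ℝ) < (1 + lam) ^ 10 := pow_pos (by linarith) 10
  have hF1 : 0 < cxW lam qp qm 1 (fun p => decide (p.2 = 0)) := by
    show 0 < cxWeight 1 lam (fun p => 1 - occP qp qm (decide (p.2 = 0))) / (1 + lam) ^ 10
    exact div_pos (cxWeight_one_ref_pos hlam0 hqp1 (hqlt.trans hqp1)) h10
  have hF : cxW lam qp qm 1 (fun p => decide (p.2 = 0)) < cxW lam qp qm 0 (fun p => decide (p.2 = 0)) := by
    show cxWeight 1 lam (fun p => 1 - occP qp qm (decide (p.2 = 0))) / (1 + lam) ^ 10 <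
      cxWeight 0 lam (fun p => 1 - occP qp qm (decide (p.2 = 0))) / (1 + lam) ^ 10
    refine div_lt_div_of_pos_right ?_ h10
    rw [← sub_pos, cxWeight_zero_sub_one_ref]
    exact mul_pos (pow_pos hlam0 4) (pow_pos (sub_pos.2 hqlt) 3)
  have hF0 : 0 < cxW lam qp qm 0 (fun p => decide (p.2 = 0)) := hF1.trans hF
  set F0 : ℝ := cxW lam qp qm 0 (fun p => decide (p.2 = 0)) with hF0def
  set F1 : ℝ := cxW lam qp qm 1 (fun p => decide (p.2 = 0)) with hF1def
  -- the parameters (S7)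
  have hη : 0 < η₃ zigzagParams.η zigzagParams.d := η₃_pos zigzagParams.η_pos zigzagParams.d
  obtain ⟨θ', hθ', k, hk1, hk⟩ := stub_parameters hθ₀ hη hF1 hF zigzagParams.d n₀
  refine ⟨θ', hθ', fun N₀ => ?_⟩
  obtain ⟨m₁, hm₁⟩ := hk N₀
  let M : ℕ := m₁ * 2 * (zigzagParams.d + 1)
  let n' : ℕ := 2 * M ^ k
  let κ : ℕ := ⌈Real.log (4 * (M : ℝ)) / Real.log (F0 / F1)⌉₊
  let K : ℕ := ⌊η₃ zigzagParams.η zigzagParams.d * M / 7⌋₊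
  obtain ⟨hN₀M, hn₀n, hκL, h2κ, hSD, herr, hε1, hK6, hM2, hK1, hdepth⟩ :=
    hm₁ m₁ le_rfl M n' κ K rfl rfl rfl rfl
  -- the base: 3-regular η₃-edge-expander on `M` vertices without half-edges (PROVED in tree)
  let R : RotGraph M 3 := base3 (zigzagParams.R m₁)
  have hexp : EdgeExpansion R (η₃ zigzagParams.η zigzagParams.d) :=
    edgeExpansion_base3 _ (zigzagParams.expands m₁)
  have hNF : NoFixed R := noFixed_base3 _
  have hMpos : 0 < M := by omega
  -- ports, port matching, sample space
  obtain ⟨P, τ, hPτ⟩ := exists_portMatching (L := M ^ k) (κ := κ) hκL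
  have heven : Even n' := ⟨M ^ k, two_mul _⟩
  have hGS : (GSample n' (Δ - 1)).Nonempty := gsample_nonempty (M ^ k) (Δ - 1)
  have hε0 : (0 : ℝ) ≤ (n' : ℝ) ^ (-θ₀) := Real.rpow_nonneg (Nat.cast_nonneg _) _
  -- the port law (S2) and the connector (S3)
  have hlaw : ∀ kk : PortPat κ, |gadG P τ (Δ - 1) lam kk - mixLaw qp qm kk * gadTot τ (Δ - 1) lam| ≤
      (n' : ℝ) ^ (-θ₀) * (mixLaw qp qm kk * gadTot τ (Δ - 1) lam) :=
    hS2 n' hn₀n heven κ h2κ P τ hPτ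
  obtain ⟨C₁, hC₁, hconn⟩ :=
    stub_annealedConnector R P τ hNF hGS hlam0 hqm hqlt hqp1 hε0 hε1 hlaw
  -- the Tseitin sum (S4) and the factor 3
  let w₀ : Fin M := ⟨0, hMpos⟩
  have hts := stub_tseitinSum hexp hNF lam qp qm κ w₀
  have hA0 : 0 ≤ acA R lam qp qm κ 0 := acA_nonneg R hlam0.le (hqlt.le.trans hqp1.le) hqp1.le κ 0
  have hA1 : 0 ≤ acA R lam qp qm κ (Pi.single w₀ 1) :=
    acA_nonneg R hlam0.le (hqlt.le.trans hqp1.le) hqp1.le κ _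
  have hcxF0 : cxF lam qp qm κ 0 = F0 ^ κ := rfl
  have hcxF1 : cxF lam qp qm κ 1 = F1 ^ κ := rfl
  rw [hcxF0, hcxF1] at hts
  have hSpos : 0 < F0 ^ κ + F1 ^ κ := add_pos (pow_pos hF0 κ) (pow_pos hF1 κ)
  have hDnn : 0 ≤ F0 ^ κ - F1 ^ κ := sub_nonneg.2 (pow_le_pow_left₀ hF1.le hF.le κ)
  have hthird : 3 * acA R lam qp qm κ (Pi.single w₀ 1) ≤ acA R lam qp qm κ 0 :=
    acA_odd_le_third hA0 (pow_pos hSpos M) (pow_nonneg hDnn M) hts hSD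
  -- the annealed twin inequality
  have hmoment : 2 * annZ R P τ (Δ - 1) (Pi.single w₀ 1) lam ≤ annZ R P τ (Δ - 1) 0 lam := by
    obtain ⟨hlo0, -⟩ := hconn 0
    obtain ⟨-, hup1⟩ := hconn (Pi.single w₀ 1)
    have hP1 : 0 ≤ (1 + (n' : ℝ) ^ (-θ₀)) ^ (3 * M) := pow_nonneg (by linarith) _
    calc 2 * annZ R P τ (Δ - 1) (Pi.single w₀ 1) lam
        ≤ 2 * ((1 + (n' : ℝ) ^ (-θ₀)) ^ (3 * M) * (C₁ * acA R lam qp qm κ (Pi.single w₀ 1))) :=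
          mul_le_mul_of_nonneg_left hup1 (by norm_num)
      _ ≤ 2 * ((1 + (n' : ℝ) ^ (-θ₀)) ^ (3 * M) * (C₁ * (acA R lam qp qm κ 0 / 3))) := by
          have h3 : acA R lam qp qm κ (Pi.single w₀ 1) ≤ acA R lam qp qm κ 0 / 3 := by linarith
          have := mul_le_mul_of_nonneg_left h3 hC₁.le
          exact mul_le_mul_of_nonneg_left (mul_le_mul_of_nonneg_left this hP1) (by norm_num)
      _ = (2 * (1 + (n' : ℝ) ^ (-θ₀)) ^ (3 * M)) * (C₁ * acA R lam qp qm κ 0) / 3 := by ring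
      _ ≤ (3 * (1 - (n' : ℝ) ^ (-θ₀)) ^ (3 * M)) * (C₁ * acA R lam qp qm κ 0) / 3 := by
          have hX : 0 ≤ C₁ * acA R lam qp qm κ 0 := mul_nonneg hC₁.le hA0
          have := mul_le_mul_of_nonneg_right herr hX
          linarith
      _ = (1 - (n' : ℝ) ^ (-θ₀)) ^ (3 * M) * (C₁ * acA R lam qp qm κ 0) := by ring
      _ ≤ annZ R P τ (Δ - 1) 0 lam := hlo0
  -- ONE sample (the lever)
  have hΩ : (Fintype.piFinset (fun _ : Dart M 3 => GSample n' (Δ - 1))).Nonempty :=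
    Fintype.piFinset_nonempty.2 fun _ => hGS
  obtain ⟨Sstar, hSΩ, hle⟩ := exists_twin_of_sum_le _ hΩ
    (fun S => independencePolynomial (acGraph R P τ S 0) lam)
    (fun S => independencePolynomial (acGraph R P τ S (Pi.single w₀ 1)) lam)
    (by simpa only [annZ] using hmoment)
  have hSfpf : ∀ δ i, Sstar δ i ∈ fpfInv (Fin n') := fun δ i =>
    Fintype.mem_piFinset.1 (Fintype.mem_piFinset.1 hSΩ δ) i
  -- the two graphs of the sample
  let X : SimpleGraph (PWVert M n' κ) := acGraph R P τ Sstar 0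
  let X' : SimpleGraph (PWVert M n' κ) := acGraph R P τ Sstar (Pi.single w₀ 1)
  let N : ℕ := Fintype.card (PWVert M n' κ)
  have hNcard : N = 6 * M * n' + 10 * M * κ := card_PWVert M n' κ
  let e : PWVert M n' κ ≃ Fin N := Fintype.equivFin (PWVert M n' κ)
  have hΔ1 : Δ - 1 + 1 = Δ := by omega
  have hdm3 : 3 ≤ Δ - 1 + 1 := by omega
  have hdegX : X.maxDegree ≤ Δ := by
    have := maxDegree_acGraph hdm3 R P hPτ hSfpf 0
    rwa [hΔ1] at this
  have hdegX' : X'.maxDegree ≤ Δ := by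
    have := maxDegree_acGraph hdm3 R P hPτ hSfpf (Pi.single w₀ 1)
    rwa [hΔ1] at this
  have hck : CkEquiv K X X' := stub_duplicator hexp hM2 P τ Sstar 0 (Pi.single w₀ 1) hK6
  refine ⟨N, X.map e.toEmbedding, X'.map e.toEmbedding, ?_, ?_, ?_, ?_, ?_⟩
  · -- order `≥ N₀`
    have hn'1 : 1 ≤ n' := Nat.mul_pos (by norm_num) (pow_pos hMpos k)
    have hMN : M ≤ N := by
      rw [hNcard]
      calc M = M * 1 := (mul_one M).symm
        _ ≤ 6 * M * n' := Nat.mul_le_mul (Nat.le_mul_of_pos_left M (by norm_num)) hn'1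
        _ ≤ 6 * M * n' + 10 * M * κ := Nat.le_add_right _ _
    exact hN₀M.trans hMN
  · -- maximum degree of the first twin
    exact maxDegree_le_of_iso (SimpleGraph.Iso.map e X) hdegX
  · -- maximum degree of the second twin
    exact maxDegree_le_of_iso (SimpleGraph.Iso.map e X') hdegX'
  · -- homomorphism indistinguishability below treewidth `N ^ θ' ≤ K`
    intro mF F hFtw
    have hNK : ((N : ℕ) : ℝ) ^ θ' ≤ K := by
      rw [hNcard]; exact hdepth
    have hKF : (treewidth F : ℝ) < K := hFtw.trans_le hNK
    have hKF' : treewidth F < K := by exact_mod_cast hKF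
    have hck' : CkEquiv K (X.map e.toEmbedding) (X'.map e.toEmbedding) :=
      hck.iso_congr (SimpleGraph.Iso.map e X) (SimpleGraph.Iso.map e X')
    exact Literature.ModelTheory.FiniteModelTheory.Dvorak2010.homCount_eq_of_ckEquiv hK1 hck' F hKF'
  · -- the factor-2 gap, transported to `Fin N`
    have hZ : 2 * independencePolynomial X' lam ≤ independencePolynomial X lam := hle
    rw [← independencePolynomial_map_equiv X e lam, ← independencePolynomial_map_equiv X' e lam] at hZ
    convert hZ using 2 <;> exact indepSum_eq _ _

end Summit.PneNP.PneNP.Cruxes.PolyDepthTwinsAbove.AnnealedCoverTwins
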